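import Summits.AtomisticToContinuum.Crystallization.Theses.PhononSlackCertificates
import Summits.AtomisticToContinuum.Crystallization.Theorems.PhononSlackCertificatesAllBadGap
import Summits.AtomisticToContinuum.Crystallization.Theorems.ChargedEnergyGap.Negative.Unconditional
import Literature.MathematicalPhysics.StatisticalMechanics.LennardJonesClusters

/-!
# `FarFieldGapR` (stmt-AtomisticToContinuum-14969), negative side: badness is load-bearing, and the shape of a kill

Support file for the crux `PhononSlackCertificates.FarFieldGapR` (refuter, cdisprove seat,
cycle 1).  Nothing here closes the item; no definition is introduced.

* `not_withoutBad` — the hypothesis "`U` consists of `1/20`-BAD particles" is load-bearing (all of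
  `g > 0` is about bad particles): with it dropped, Lennard-Jones GROUND STATES, which are
  `δ₀`-separated (`LennardJonesMinimalDistance_holds`, proved) and have `E(N) = N e* + o(N)`
  (`crysEnergyLimit`, proved), beat every `g > 0` with `U =` everything (empty boundary).
* `not_farFieldGapR_of_allBad_tie` — the route's kill criterion (i) made formal: an all-bad
  `δ`-separated family with `𝓔 < N (e* + g)` for EVERY `g > 0` refutes the crux (through the
  landed `allBadGap_of_farFieldGapR`).  Why the crux resists: certifying such a family needs
  `e* = ⨅_Q e(Q)` from BELOW to within the all-bad energy deficit — the open identification of the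
  periodic Lennard-Jones minimum (BlancLewin2015 §2.3); the tree knows `e*` only through
  competitors from above (`card_mul_eStar_le`) and an inexplicit stability constant from below.
* `neg_eStar_pos_of_farFieldGapR` — the crux forces `e* < 0` (one particle alone: `U = {0}` is
  bad, has empty boundary and excess `-e*`, so `0 < g ≤ -e*`); true, `e* ≤ E(2)/2 = -1/24`.

All `[folklore]`.
-/

noncomputable section

namespace Summit.AtomisticToContinuum.Crystallization.Theorems.FarFieldGapRNegative

open scoped BigOperators Classical
open Literature.MathematicalPhysics.StatisticalMechanics Literature.Geometry.DiscreteGeometry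
open Summit.AtomisticToContinuum.Crystallization.Theses.PhononSlackCertificates
  (AllBadGap FarFieldGapR)
open Summit.AtomisticToContinuum.Crystallization.Theorems.ChargedEnergyGapNegative
  (E3 eStar crysEnergyLimit)
open Summit.AtomisticToContinuum.Crystallization.Theorems.PhononSlackCertificatesAllBadGap
  (exists_mem_norm_eq_one sum_univ_half_site_sub allBadGap_of_farFieldGapR)

/-! ## Badness of `U` is load-bearing -/

/-- **Badness is load-bearing** (all of `g > 0` is about bad particles): Lennard-Jones GROUND
STATES `x^N` are `δ₀`-separated (`LennardJonesMinimalDistance_holds`) and have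
`𝓔(x^N) - N e* = E(N) - N e* = o(N)` (`crysEnergyLimit`), so `U =` all particles (empty boundary)
beats `g · N` for large `N`.  PROVED tree facts only. [folklore] -/
theorem not_withoutBad :
    ¬ ∀ δ : ℝ, 0 < δ → ∃ g : ℝ, 0 < g ∧ ∃ C R : ℝ, ∀ (N : ℕ) (x : Fin N → E3),
      (∀ i j : Fin N, i ≠ j → δ ≤ dist (x i) (x j)) → ∀ U : Finset (Fin N),
        g * (U.card : ℝ) -
            C * (Nat.card {i : Fin N // i ∈ U ∧ ∃ j : Fin N, j ∉ U ∧ dist (x j) (x i) ≤ R} : ℝ) ≤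
          ∑ i ∈ U, ((1 / 2 : ℝ) * (∑ j ∈ Finset.univ.erase i, lennardJones (dist (x i) (x j))) -
            eStar) := by
  intro h
  obtain ⟨δ, hδ, hmin⟩ := LennardJonesMinimalDistance_holds
  obtain ⟨g, hg, C, R, hAt⟩ := h δ hδ
  have hlim : (⨅ Q : PeriodicConfiguration 3, Q.energyPerParticle lennardJones) < eStar + g := by
    show eStar < eStar + g
    linarith
  have hev : ∀ᶠ N : ℕ in Filter.atTop, groundStateEnergy lennardJones 3 N / N < eStar + g :=
    crysEnergyLimit.eventually (gt_mem_nhds hlim)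
  obtain ⟨N, hEN, hN1⟩ := (hev.and (Filter.eventually_ge_atTop 1)).exists
  obtain ⟨x, hx⟩ := LennardJonesGroundStatesExist_holds N
  have hsep : ∀ i j : Fin N, i ≠ j → δ ≤ dist (x i) (x j) := hmin N x hx
  have key := hAt N x hsep Finset.univ
  haveI : IsEmpty {i : Fin N // i ∈ (Finset.univ : Finset (Fin N)) ∧
      ∃ j : Fin N, j ∉ (Finset.univ : Finset (Fin N)) ∧ dist (x j) (x i) ≤ R} :=
    ⟨fun ⟨_, _, j, hj, _⟩ => hj (Finset.mem_univ j)⟩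
  rw [Nat.card_of_isEmpty, sum_univ_half_site_sub, Finset.card_univ, Fintype.card_fin, hx.2] at key
  have hNpos : (0 : ℝ) < N := by exact_mod_cast hN1
  have hE : groundStateEnergy lennardJones 3 N < (eStar + g) * N := by
    rwa [div_lt_iff₀ hNpos] at hEN
  push_cast at key
  nlinarith

/-! ## What a kill must look like -/

/-- **Kill criterion, formal**: an all-bad `δ`-separated family whose energy comes within `g N`
of `N e*` for EVERY `g > 0` refutes the crux.  The catch (why the crux resists): certifying
`𝓔(x) < N (e* + g)` needs a LOWER bound on `e* = ⨅_Q e(Q)` matching the family — the open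
identification of the periodic Lennard-Jones minimum. [folklore] -/
theorem not_farFieldGapR_of_allBad_tie
    (h : ∃ δ : ℝ, 0 < δ ∧ ∀ g : ℝ, 0 < g → ∃ (N : ℕ) (x : Fin N → E3),
      (∀ i j : Fin N, i ≠ j → δ ≤ dist (x i) (x j)) ∧
        (∀ i, ¬ IsTwoShellGood (1 / 20) (47 / 50) 1 x i) ∧
          interactionEnergy lennardJones x < N * (eStar + g)) :
    ¬ FarFieldGapR := by
  intro hF
  obtain ⟨δ, hδ, htie⟩ := h
  obtain ⟨g, hg, hgap⟩ := allBadGap_of_farFieldGapR hF δ hδ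
  obtain ⟨N, x, hsep, hbad, hlt⟩ := htie g hg
  have := hgap N x hsep hbad
  change (N : ℝ) * (eStar + g) ≤ _ at this
  linarith

/-! ## The crux forces `e* < 0` -/

/-- **`FarFieldGapR → 0 < -e*`**: one particle alone (`N = 1`, `U = {0}`: bad since there is
nobody to match a pattern point, empty boundary, excess site energy `-e*`) gives `0 < g ≤ -e*`.
[folklore] -/
theorem neg_eStar_pos_of_farFieldGapR (h : FarFieldGapR) : 0 < -eStar := by
  obtain ⟨g, hg, C, R, hAt⟩ := h 1 one_pos
  have hbad : ∀ i ∈ (Finset.univ : Finset (Fin 1)),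
      ¬ IsTwoShellGood (1 / 20) (47 / 50) 1 (fun _ : Fin 1 => (0 : E3)) i := by
    rintro i - ⟨a, -, -, A, P, f, hP, hf, -, -⟩
    obtain ⟨v, hv, -⟩ := exists_mem_norm_eq_one hP
    exact (hf v hv).1 (Subsingleton.elim _ _)
  have key := hAt 1 (fun _ => 0) (fun i j hij => absurd (Subsingleton.elim i j) hij) Finset.univ hbad
  haveI : IsEmpty {i : Fin 1 // i ∈ (Finset.univ : Finset (Fin 1)) ∧
      ∃ j : Fin 1, j ∉ (Finset.univ : Finset (Fin 1)) ∧
        dist ((fun _ => (0 : E3)) j) ((fun _ => (0 : E3)) i) ≤ R} :=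
    ⟨fun ⟨_, _, j, hj, _⟩ => hj (Finset.mem_univ j)⟩
  rw [Nat.card_of_isEmpty, sum_univ_half_site_sub, Finset.card_univ, Fintype.card_fin,
    interactionEnergy_of_subsingleton] at key
  push_cast at key
  show 0 < -(⨅ Q : PeriodicConfiguration 3, Q.energyPerParticle lennardJones)
  linarith

end Summit.AtomisticToContinuum.Crystallization.Theorems.FarFieldGapRNegative

end
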